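import Summits.FinalStateConjecture.FinalStateConjecture.Theses.PhaseMixingCapture
import Summits.FinalStateConjecture.FinalStateConjecture.Theorems.PhaseMixingCaptureCaptureSufficesC2Implications
import Summits.FinalStateConjecture.FinalStateConjecture.Theorems.PhaseMixingCaptureWeakCosmicCensorshipMGHD

/-!
# `CaptureSufficesC2` (item stmt-FinalStateConjecture-14986, route `PhaseMixingCapture`, support rank 6):
# its censorship hypothesis is ELIMINABLE, so the item is "Kerr capture alone ⟹ the summit"

`CaptureSufficesC2 := NearExtremalKappaCapture → BulkKerrCaptureC2 → WeakCosmicCensorshipMGHD →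
FinalStateConjecture`. After the statement revision p126844 the conclusion (the summit BY NAME) is
TAME-generic while the third hypothesis kept the topology-free curve-genericity
`IsChristodoulouGeneric`, for which the burial construction of the retired route SwallowTheDatum is a
legal witness supply: `WeakCosmicCensorshipMGHD` is a theorem of the tree CONDITIONAL on the three
SwallowTheDatum items (`WeakCosmicCensorshipMGHD_of : MGHDExists → SubdataDevelopmentsEmbed →
ParametricKerrBurial → WeakCosmicCensorshipMGHD`, no Einstein dynamics). Kernel-checked consequences,
definition-free, complementing `…CaptureSufficesC2Implications.lean` (p131699); statements are kept on
one physical line with fully qualified names (registered sub-goals of the item):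

* `captureSufficesC2_iff_captureOnly_of_wcc` — granted `WeakCosmicCensorshipMGHD`, the item is
  LITERALLY `NearExtremalKappaCapture → BulkKerrCaptureC2 → FinalStateConjecture`: the two Kerr
  stability statements alone would have to give the whole re-typed summit, tame weak cosmic
  censorship for large data included (`tameCensorship_of_captureOnly`);
* `captureSufficesC2_iff_captureOnly_of_burial` — the same modulo the three SwallowTheDatum items by
  name (burial through every admissible datum, exterior ignorance, Choquet-Bruhat–Geroch);
* `captureSufficesC2_iff_cruxes_of_wcc` — granted `WeakCosmicCensorshipMGHD`, the item is EQUIVALENT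
  to the conjunction "rank-6 crux `CaptureSufficesTame` ∧ (capture ⟹ rank-5 crux
  `WeakCosmicCensorshipTame`)": it sits above BOTH live cruxes of the route, so it is not a support
  lemma of `closes` but an implication record, provable only after stmt-17270 AND (under capture)
  stmt-17269.
-/

-- the doubled `FinalStateConjecture.FinalStateConjecture` path component trips dupNamespace
set_option linter.dupNamespace false

noncomputable section

namespace Summit.FinalStateConjecture.FinalStateConjecture.Theorems.PhaseMixingCaptureCaptureSufficesC2

open Summit.FinalStateConjecture.FinalStateConjecture.Theses.PhaseMixingCapture
  (NearExtremalKappaCapture BulkKerrCaptureC2 WeakCosmicCensorshipMGHD WeakCosmicCensorshipTame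
    CaptureSufficesC2 CaptureSufficesTame)
open Summit.FinalStateConjecture.FinalStateConjecture.Theorems.PhaseMixingCapture.WeakCosmicCensorshipMGHD
  (WeakCosmicCensorshipMGHD_of)

/-- **The censorship hypothesis is eliminable.** Granted `WeakCosmicCensorshipMGHD` (topology-free
curve-genericity), `CaptureSufficesC2` is literally "κ-explicit near-extremal capture and C²-handing
bulk capture give the re-typed summit". [folklore] -/
theorem captureSufficesC2_iff_captureOnly_of_wcc : Summit.FinalStateConjecture.FinalStateConjecture.Theses.PhaseMixingCapture.WeakCosmicCensorshipMGHD → (Summit.FinalStateConjecture.FinalStateConjecture.Theses.PhaseMixingCapture.CaptureSufficesC2 ↔ (Summit.FinalStateConjecture.FinalStateConjecture.Theses.PhaseMixingCapture.NearExtremalKappaCapture → Summit.FinalStateConjecture.FinalStateConjecture.Theses.PhaseMixingCapture.BulkKerrCaptureC2 → _root_.FinalStateConjecture)) :=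
  fun hW ↦ ⟨fun h h₁ h₂ ↦ h h₁ h₂ hW, fun h h₁ h₂ _ ↦ h h₁ h₂⟩

/-- **The same modulo the three SwallowTheDatum items** (Choquet-Bruhat–Geroch existence `MGHDExists`,
exterior ignorance `SubdataDevelopmentsEmbed`, the parametric Kerr burial `ParametricKerrBurial`):
the in-tree burial proof `WeakCosmicCensorshipMGHD_of` discharges the third hypothesis, so the item
reduces to "Kerr capture ⟹ the summit" with NO censorship input. [folklore] -/
theorem captureSufficesC2_iff_captureOnly_of_burial : Summit.FinalStateConjecture.FinalStateConjecture.Theses.SwallowTheDatum.MGHDExists → Summit.FinalStateConjecture.FinalStateConjecture.Theses.SwallowTheDatum.SubdataDevelopmentsEmbed → Summit.FinalStateConjecture.FinalStateConjecture.Theses.SwallowTheDatum.ParametricKerrBurial → (Summit.FinalStateConjecture.FinalStateConjecture.Theses.PhaseMixingCapture.CaptureSufficesC2 ↔ (Summit.FinalStateConjecture.FinalStateConjecture.Theses.PhaseMixingCapture.NearExtremalKappaCapture → Summit.FinalStateConjecture.FinalStateConjecture.Theses.PhaseMixingCapture.BulkKerrCaptureC2 → _root_.FinalStateConjecture)) 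:=
  fun hM hE hB ↦ captureSufficesC2_iff_captureOnly_of_wcc (WeakCosmicCensorshipMGHD_of hM hE hB)

/-- **What the item then asserts about censorship.** Granted `WeakCosmicCensorshipMGHD`, the item makes
the two Kerr capture statements imply TAME weak cosmic censorship with MGHD existence for one-ended
asymptotically flat vacuum data (the live rank-5 crux `WeakCosmicCensorshipTame`, stmt-17269) — the
summit implies it (`tameCensorship_of_finalStateConjecture`). [folklore] -/
theorem tameCensorship_of_captureOnly : Summit.FinalStateConjecture.FinalStateConjecture.Theses.PhaseMixingCapture.WeakCosmicCensorshipMGHD → Summit.FinalStateConjecture.FinalStateConjecture.Theses.PhaseMixingCapture.CaptureSufficesC2 → Summit.FinalStateConjecture.FinalStateConjecture.Theses.PhaseMixingCapture.NearExtremalKappaCapture → Summit.FinalStateConjecture.FinalStateConjecture.Theses.PhaseMixingCapture.BulkKerrCaptureC2 → Summit.FinalStateConjecture.FinalStateConjecture.Theses.PhaseMixingCapture.WeakCosmicCensorshipTame :=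
  fun hW h h₁ h₂ X _ _ _ _ _ _ ↦ tameCensorship_of_finalStateConjecture (h h₁ h₂ hW) X

/-- **Position among the live cruxes, censorship granted.** Granted `WeakCosmicCensorshipMGHD`, the
item is EQUIVALENT to the rank-6 crux `CaptureSufficesTame` (stmt-17270) together with "capture ⟹
the rank-5 crux `WeakCosmicCensorshipTame` (stmt-17269)": strictly a conjunction over both live
cruxes, hence an implication record and not a hypothesis-grade support of `closes`. [folklore] -/
theorem captureSufficesC2_iff_cruxes_of_wcc : Summit.FinalStateConjecture.FinalStateConjecture.Theses.PhaseMixingCapture.WeakCosmicCensorshipMGHD → (Summit.FinalStateConjecture.FinalStateConjecture.Theses.PhaseMixingCapture.CaptureSufficesC2 ↔ Summit.FinalStateConjecture.FinalStateConjecture.Theses.PhaseMixingCapture.CaptureSufficesTame ∧ (Summit.FinalStateConjecture.FinalStateConjecture.Theses.PhaseMixingCapture.NearExtremalKappaCapture → Summit.FinalStateConjecture.FinalStateConjecture.Theses.PhaseMixingCapture.BulkKerrCaptureC2 → Summit.FinalStateConjecture.FinalStateConjecture.Theses.PhaseMixingCapture.WeakCosmicCensorshipTame)) :=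
  fun hW ↦ ⟨fun h ↦ ⟨captureSufficesTame_of_captureSufficesC2 h, tameCensorship_of_captureOnly hW h⟩,
    fun ⟨h₆, hup⟩ h₁ h₂ _ ↦ h₆ h₁ h₂ (hup h₁ h₂)⟩

end Summit.FinalStateConjecture.FinalStateConjecture.Theorems.PhaseMixingCaptureCaptureSufficesC2

end
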